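/-
Copyright (c) 2026 the pub-hodgecm2 formalisation cell (harness21).  New file, outside the frozen port manifest.
Origin: wall-breaker seat `prover-pub-hodgecm2-d2bridge-wb-7-g0-0` (WB-7), re-pointed by the coordinator (HOME/INBOX relay
2026-08-23T21:10Z) to ORIENTATION-MEMO v1.3 §4 **T1 KERNEL TEST**: `span (cmClasses K i) ≤ F¹` at `PhiMu` lines.
THEOREMS ONLY; nothing landed is edited or restated; no named fact, no instance, no `sorry`.
FRAMING: HC_CM is NOT proved; «Δ2 BRIDGE CLOSED» is NOT claimed.  This file is an AUDIT INPUT: it makes the memo's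
step (C) — «every admissible CM record of a `PhiMu` line carries a class of Hodge type `(1,0)`, hence so does every
pull-back» — a tree theorem, by TRANSPORT along the tree's own comparison lemmas (no new Hodge theory).
-/
import Summits.HodgeConjecture.HodgeCM.Model.LiuDictionaryPin
import HarnessLib

/-!
# Δ2 bridge, orientation audit T1: the dictionary's CM classes at a `PhiMu` line are of Hodge type `(1,0)`

For the pinned Liu dictionary `liuDictionaryPin hHD hI h₁ h₃ hA V I line` ([Liu2021] Thm 4.18 reading r8 at the model;
`HodgeCM/Model/LiuDictionaryPin.lean`) the generator set of the `h418` clause at an index line `i` and a level `Γ` is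
`cmClasses Γ i = ⋃ {f^*_ℂ α_d | d admissible for i, f : P_Γ ⟶ A_d}` (`LiuDictionary.cmClasses`, `geomClass Γ d f =
(pull f 1).baseChange ℂ d.α`), with `adm i d := d.IsReflexOfTypeG ι₁ (typeOfLine (line i))` (keyed at `ι₁`).

* §1 (orientation-free CORE) `geomClass_mem_hodgeF_one`: if the record's eigencharacter lies in its CM type,
  `d.τ ∈ d.ΦA`, then `geomClass Γ d f ∈ F¹ H¹(P_Γ)` — the last step of the Hodge filtration of the universe's Hodge
  structure `(picardCMUniverse …).hodge (pms L ι₁ V Γ) 1` (`BettiUniverse.hodge`).  TRANSPORT CHAIN, all tree lemmas: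
  `d.α_mem` (joint `τ`-eigenvector of the complexified RATIONAL action `complexify (cmAction d.θA _)`) ↦
  `BettiUniverse.ofRatClassBaseChange_cmAction` (under `β : ℂ ⊗_ℚ H¹(A;ℚ) → H¹(A;ℂ)` it is a `τ`-eigenvector of `d.θA`) ↦
  `d.isRealisation` (`IsCMTypeRealisation`, clause «`τ ∈ ΦA →` type `(1,0)`») ↦ `BettiUniverse.mem_hodge_F_one_iff` (`hI`) ↦
  `BettiUniverse.pull_hodge` along `f`.
* §2 (any dictionary) `cmClasses_subset_hodgeF_one`, `span_cmClasses_le_hodgeF_one`: for `T : LiuDictionary … V` and a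
  character `μ` all of whose admissible records have `d.τ ∈ d.ΦA`, `span ℂ (T.cmClasses Γ μ) ≤ F¹`.
* §3 (THE PIN, T1 as asked) `span_cmClasses_liuDictionaryPin_le_hodgeF_one`: at the pinned dictionary, for `L/ℚ` Galois and an
  index line with `PhiMuLine ι₁ (line i)` (`= ι₁ ∈ Φ_{line i}`), GIVEN the orientation lemma of the audit in its printed shape
  `horient : ∀ d, d.IsReflexOfType ι₁ (typeOfLine (line i)) → d.τ ∈ d.ΦA.1` (own-crow g93 `tau_mem_cmType_of_isReflexOfType`,
  desk file `OrientationReflexConj.lean`, being filed as `CorCM/D2Bridge/OrientationReflexConj.lean` — imported and discharged in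
  the sequel the moment it lands; not restated here), `span ℂ (cmClasses Γ i) ≤ F¹ H¹(P_Γ)`.

References: [Liu2021] Y. Liu, arXiv:2102.11518, Thm. 4.18 and its proof (TeX ll. 2232–2250: the class `α` is a
`τ'`-eigenvector in `H¹_{B,τ'}(A_μ, ℂ)`); [Shimura1998] §5.2 pp. 36–37 (the CM type read on holomorphic one-forms);
[VoisinHodgeI2002] §7.3.2 (pull-back is a morphism of Hodge structures).
-/

set_option autoImplicit false

noncomputable section

open scoped TensorProduct

namespace Summit.HodgeConjecture.CorCM.D2Bridge

open CategoryTheory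
open Literature.AlgebraicGeometry.Motives (CMType bettiCohomology)
open Literature.AlgebraicGeometry.HodgeTheory
open Literature.AlgebraicGeometry.HodgeTheory.BettiUniverse (pull cmAction ofRatClassBaseChange_cmAction
  mem_hodge_F_one_iff pull_hodge)
open Literature.AlgebraicGeometry.ComplexMultiplication (IsCMTypeRealisation)
open Literature.NumberTheory.Automorphic.PicardCM
open HodgeCM HodgeCM.Model HodgeCM.Model.LiuDictionary
open HodgeCM.CM.CommonReflex (complexify mem_eigenline_complexify_iff)

/-! ## §0 A CM record whose eigencharacter lies in its CM type carries a class of type `(1,0)` -/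

/-- Under the comparison `β : ℂ ⊗_ℚ H¹(A_d; ℚ) → H¹(A_d; ℂ)` the record's class `d.α` (a joint `d.τ`-eigenvector of the
complexified RATIONAL CM action, `d.α_mem`) is a joint `d.τ`-eigenvector of the complex action `d.θA`
(`BettiUniverse.ofRatClassBaseChange_cmAction`). [cite: Shimura1998, §3.2 pp. 20–22] -/
theorem ofRatClassBaseChange_α_mem_eigenline (d : LiuCMSide) :
    Literature.AlgebraicGeometry.Motives.ofRatClassBaseChange (Literature.AlgebraicGeometry.Motives.ComplexPoints d.A.X) 1 d.α ∈
      eigenline d.θA d.τ := by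
  have hα := (mem_eigenline_complexify_iff _ _ _).1 d.α_mem
  refine (Submodule.mem_iInf _).2 fun a => ?_
  rw [Module.End.mem_eigenspace_iff, ← ofRatClassBaseChange_cmAction d.θA d.isRealisation.isInducedOnIntegers a d.α,
    hα a, map_smul]

/-- **A record with `d.τ ∈ d.ΦA` has `d.α ∈ F¹ H¹(A_d)`** (the Hodge filtration of `BettiUniverse.hodge` on `ℂ ⊗_ℚ H¹(A_d; ℚ)`):
the `IsCMTypeRealisation` clause «`σ ∈ Φ →` the `σ`-eigenline is of type `(1,0)`» at `σ = d.τ`, read back through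
`BettiUniverse.mem_hodge_F_one_iff`. [cite: Shimura1998, §5.2 pp. 36–37] -/
theorem α_mem_hodgeF_one (hHD : exists_isReal_hodgeModel) (hI : hodgePQ_independent_of_hodgeModel)
    (d : LiuCMSide) (hτ : d.τ ∈ d.ΦA.1) :
    d.α ∈ (BettiUniverse.hodge hHD d.isRealisation.1 1).F 1 :=
  (mem_hodge_F_one_iff hHD hI d.isRealisation.1 d.α).2
    ((d.isRealisation.2.2.2 d.τ).2.1 hτ _ (ofRatClassBaseChange_α_mem_eigenline d))

/-! ## §1 The orientation-free core: pull-backs of such classes lie in `F¹ H¹(P_Γ)` -/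

/-- **CORE (orientation-free).**  For a CM record `d` with `d.τ ∈ d.ΦA` and any `ℂ`-morphism `f : P_Γ ⟶ A_d` from the realised
surface of the universe of record, the geometric class `geomClass Γ d f = f^*_ℂ α_d` lies in `F¹ H¹(P_Γ; ℂ)` — pull-back is a morphism
of Hodge structures (`BettiUniverse.pull_hodge`, over `hI`). [cite: VoisinHodgeI2002, §7.3.2] -/
theorem geomClass_mem_hodgeF_one (hHD : exists_isReal_hodgeModel) (hI : hodgePQ_independent_of_hodgeModel)
    (h₁ : BallQuotientUniformised) (h₃ : CMAbelianVarietyRealised)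
    {L : CMField} {ι₁ : (L : Type) →+* ℂ} (V : HermSpace3 L ι₁) (d : LiuCMSide) (hτ : d.τ ∈ d.ΦA.1) (Γ : Level V)
    (f : (pmsRealisation (ballQuotientUniformisedDatum_of h₁) (pmsCode L ι₁ V Γ)).X ⟶ d.A.X) :
    geomClass (hHD := hHD) (hI := hI) (h₃ := h₃) Γ d f ∈
      ((picardCMUniverse hHD hI h₁ h₃).hodge ((picardCMUniverse hHD hI h₁ h₃).pms L ι₁ V Γ) 1).F 1 :=
  pull_hodge hHD hI (Var.isSmoothProjective (ballQuotientUniformisedDatum_of h₁) h₃ (.pms (pmsCode L ι₁ V Γ)))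
    d.isRealisation.1 f 1 1 (Submodule.mem_map_of_mem (α_mem_hodgeF_one hHD hI d hτ))

/-! ## §2 Any dictionary: the CM classes of a character whose admissible records are `(1,0)`-oriented -/

/-- For a real-carrier dictionary `T` at `(L, ι₁, V)` and a character `μ` all of whose admissible records satisfy `d.τ ∈ d.ΦA`,
every class of `T.cmClasses Γ μ` lies in `F¹ H¹(P_Γ)`. [cite: VoisinHodgeI2002, §7.3.2] -/
theorem cmClasses_subset_hodgeF_one (hHD : exists_isReal_hodgeModel) (hI : hodgePQ_independent_of_hodgeModel)
    (h₁ : BallQuotientUniformised) (h₃ : CMAbelianVarietyRealised)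
    {L : CMField} {ι₁ : (L : Type) →+* ℂ} (V : HermSpace3 L ι₁) (T : LiuDictionary hHD hI h₁ h₃ V) (μ : T.Char)
    (hadm : ∀ d : LiuCMSide, T.adm μ d → d.τ ∈ d.ΦA.1) (Γ : Level V) :
    T.cmClasses Γ μ ⊆ ((picardCMUniverse hHD hI h₁ h₃).hodge ((picardCMUniverse hHD hI h₁ h₃).pms L ι₁ V Γ) 1).F 1 := by
  intro x hx
  obtain ⟨d, hd⟩ := Set.mem_iUnion.1 hx
  obtain ⟨hdμ, f, rfl⟩ := Set.mem_iUnion.1 hd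
  exact geomClass_mem_hodgeF_one hHD hI h₁ h₃ V d (hadm d hdμ) Γ f

/-- The `span` form: `span ℂ (T.cmClasses Γ μ) ≤ F¹ H¹(P_Γ)`. [cite: VoisinHodgeI2002, §7.3.2] -/
theorem span_cmClasses_le_hodgeF_one (hHD : exists_isReal_hodgeModel) (hI : hodgePQ_independent_of_hodgeModel)
    (h₁ : BallQuotientUniformised) (h₃ : CMAbelianVarietyRealised)
    {L : CMField} {ι₁ : (L : Type) →+* ℂ} (V : HermSpace3 L ι₁) (T : LiuDictionary hHD hI h₁ h₃ V) (μ : T.Char)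
    (hadm : ∀ d : LiuCMSide, T.adm μ d → d.τ ∈ d.ΦA.1) (Γ : Level V) :
    Submodule.span ℂ (T.cmClasses Γ μ) ≤
      ((picardCMUniverse hHD hI h₁ h₃).hodge ((picardCMUniverse hHD hI h₁ h₃).pms L ι₁ V Γ) 1).F 1 :=
  Submodule.span_le.2 (cmClasses_subset_hodgeF_one hHD hI h₁ h₃ V T μ hadm Γ)

/-! ## §3 T1 at the pinned dictionary of record -/

/-- **T1 (ORIENTATION-MEMO §4) at the pin, over the audit's orientation lemma.**  `L/ℚ` Galois, `i` an index line with
`PhiMuLine ι₁ (line i)` (the dictionary's `PhiMu`, `= ι₁ ∈ Φ_{line i}`), and the orientation lemma in its printed shape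
`horient` (own-crow g93 `tau_mem_cmType_of_isReflexOfType ι₁ d (typeOfLine (line i)) · hΦ`): then
`span ℂ (cmClasses Γ i) ≤ F¹ H¹(P_Γ; ℂ)` at EVERY level `Γ` — the `h418` clause's generators are classes of holomorphic one-forms.
[cite: Liu2021, Thm. 4.18 and proof (TeX ll. 2232–2250)] [cite: VoisinHodgeI2002, §7.3.2] -/
theorem span_cmClasses_liuDictionaryPin_le_hodgeF_one (hHD : exists_isReal_hodgeModel)
    (hI : hodgePQ_independent_of_hodgeModel) (h₁ : BallQuotientUniformised) (h₃ : CMAbelianVarietyRealised)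
    (hA : Literature.NumberTheory.Transcendental.Arapura2012_Cor_15_4_6)
    {L : CMField} [IsGalois ℚ (L : Type)] {ι₁ : (L : Type) →+* ℂ} (V : HermSpace3 L ι₁) (I : Type) (line : I → SplitLineE V)
    (i : I) (horient : ∀ d : LiuCMSide, d.IsReflexOfType ι₁ (SplitLine.typeOfLine (line i)) → d.τ ∈ d.ΦA.1) (Γ : Level V) :
    Submodule.span ℂ ((liuDictionaryPin hHD hI h₁ h₃ hA V I line).cmClasses Γ i) ≤
      ((picardCMUniverse hHD hI h₁ h₃).hodge ((picardCMUniverse hHD hI h₁ h₃).pms L ι₁ V Γ) 1).F 1 := by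
  refine span_cmClasses_le_hodgeF_one hHD hI h₁ h₃ V (liuDictionaryPin hHD hI h₁ h₃ hA V I line) i
    (fun d hd => horient d ?_) Γ
  -- `adm i d` of the pinned dictionary IS `d.IsReflexOfTypeG ι₁ (typeOfLine (line i))` (`liuDictionaryOfWeilFamily_adm`, `Iff.rfl`)
  have h' : d.IsReflexOfTypeG ι₁ (SplitLine.typeOfLine (line i)) :=
    (liuDictionaryOfWeilFamily_adm hHD hI h₁ h₃ hA V (ιVE V) I line (fun j χ => (line j).IsAutChar χ) i d).1 hd
  exact h' inferInstance

end Summit.HodgeConjecture.CorCM.D2Bridge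

end
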